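import Mathlib.NumberTheory.PrimeCounting
import Mathlib.Analysis.SpecialFunctions.Pow.Real
import Mathlib.Algebra.BigOperators.Module
import Literature.NumberTheory.LFunctions.MertensTail
import HarnessLib

/-!
# Levin–Faĭnleĭb mean-value theorem, I: the conditionally convergent prime sum

Topic `Literature/NumberTheory/LFunctions` (mean values of non-negative multiplicative functions).
First file of the proof of the logarithmic mean-value theorem of Levin–Faĭnleĭb (1967) /
Halberstam–Richert (*Sieve Methods*, 1974, Lemma 5.4) / Wirsing in asymptotic form
(`LevinFainleibTauberian.lean`).  Everything here is PROVED.

For a sequence `g` with prime mean `κ`, i.e. `|∑_{p ≤ Q} g(p) log p − κ log Q| ≤ L` (`Q ≥ 2`),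
Mertens' first theorem (`Literature.NumberTheory.LFunctions.MertensBound.sum_log_div_prime_bounds`)
makes the partial sums `C(N) = ∑_{p ≤ N} (g(p) − κ/p) log p` BOUNDED
(`exists_abs_sum_primesLE_sub_mul_log_le`).  Abel summation against the positive non-increasing
weight `1/(n^s log n)` (`abs_sum_Ioc_mul_le`, from Mathlib's `Finset.sum_Ioc_by_parts`) then shows
that the prime sums `M_N(s) = ∑_{p ≤ N} (g(p) − κ/p) p^{-s}` are UNIFORMLY CAUCHY in `s ≥ 0`:
`|M_N(s) − M_M(s)| ≤ 2B / log(M+1)` for `N ≥ M ≥ 1` (`abs_sum_primesLE_div_rpow_sub_le`).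
This is the only input about the primes themselves in the whole proof.

## References
* H. Halberstam, H.-E. Richert, *Sieve Methods*, Academic Press 1974, Lemma 5.3–5.4.
* B. V. Levin, A. S. Faĭnleĭb, *Application of some integral equations to problems of number
  theory*, Uspehi Mat. Nauk 22 (1967), 119–197.
-/

namespace Literature.NumberTheory.LFunctions

namespace LevinFainleib

open Finset Real

/-! ### Abel summation with bounded partial sums -/

/-- Telescoping over `Ioc a b`: `∑_{a < i ≤ b} (φ i − φ (i+1)) = φ (a+1) − φ (b+1)`. [folklore] -/
theorem sum_Ioc_sub_succ (φ : ℕ → ℝ) {a b : ℕ} (hab : a ≤ b) :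
    ∑ i ∈ Ioc a b, (φ i - φ (i + 1)) = φ (a + 1) - φ (b + 1) := by
  induction b, hab using Nat.le_induction with
  | base => simp
  | succ b hb ih => rw [Finset.sum_Ioc_succ_top hb, ih]; ring

/-- **Abel's inequality with bounded partial sums**: if `|∑_{j < k} c_j| ≤ B` for all `k` and the
weights `φ` are non-negative and non-increasing beyond `M`, then
`|∑_{M < i ≤ N} φ_i c_i| ≤ 2 B φ_{M+1}`. [folklore] -/
theorem abs_sum_Ioc_mul_le (c φ : ℕ → ℝ) {B : ℝ} {M N : ℕ} (hMN : M ≤ N)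
    (hC : ∀ k, |∑ j ∈ range k, c j| ≤ B)
    (hφ0 : ∀ i, M < i → 0 ≤ φ i) (hφ : ∀ i, M < i → φ (i + 1) ≤ φ i) :
    |∑ i ∈ Ioc M N, φ i * c i| ≤ 2 * B * φ (M + 1) := by
  have hB : 0 ≤ B := le_trans (abs_nonneg _) (hC 0)
  rcases hMN.eq_or_lt with rfl | hlt
  · simp only [Finset.Ioc_self, Finset.sum_empty, abs_zero]
    exact mul_nonneg (mul_nonneg zero_le_two hB) (hφ0 _ (Nat.lt_succ_self M))
  have key := Finset.sum_Ioc_by_parts φ c hlt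
  simp only [smul_eq_mul] at key
  rw [key]
  have h1 : |φ N * ∑ j ∈ range (N + 1), c j| ≤ φ N * B := by
    rw [abs_mul, abs_of_nonneg (hφ0 N hlt)]
    exact mul_le_mul_of_nonneg_left (hC _) (hφ0 N hlt)
  have h2 : |φ (M + 1) * ∑ j ∈ range (M + 1), c j| ≤ φ (M + 1) * B := by
    rw [abs_mul, abs_of_nonneg (hφ0 _ (Nat.lt_succ_self M))]
    exact mul_le_mul_of_nonneg_left (hC _) (hφ0 _ (Nat.lt_succ_self M))
  have h3 : |∑ i ∈ Ioc M (N - 1), (φ (i + 1) - φ i) * ∑ j ∈ range (i + 1), c j|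
      ≤ B * (φ (M + 1) - φ N) := by
    calc |∑ i ∈ Ioc M (N - 1), (φ (i + 1) - φ i) * ∑ j ∈ range (i + 1), c j|
        ≤ ∑ i ∈ Ioc M (N - 1), |(φ (i + 1) - φ i) * ∑ j ∈ range (i + 1), c j| :=
          Finset.abs_sum_le_sum_abs _ _
      _ ≤ ∑ i ∈ Ioc M (N - 1), (φ i - φ (i + 1)) * B := by
          refine Finset.sum_le_sum fun i hi => ?_
          have hiM : M < i := (Finset.mem_Ioc.mp hi).1
          rw [abs_mul, abs_sub_comm, abs_of_nonneg (sub_nonneg.mpr (hφ i hiM))]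
          exact mul_le_mul_of_nonneg_left (hC _) (sub_nonneg.mpr (hφ i hiM))
      _ = B * (φ (M + 1) - φ N) := by
          rw [← Finset.sum_mul, sum_Ioc_sub_succ φ (by omega : M ≤ N - 1), mul_comm,
            Nat.sub_add_cancel (by omega : 1 ≤ N)]
  calc |φ N * ∑ j ∈ range (N + 1), c j - φ (M + 1) * ∑ j ∈ range (M + 1), c j -
        ∑ i ∈ Ioc M (N - 1), (φ (i + 1) - φ i) * ∑ j ∈ range (i + 1), c j|
      ≤ |φ N * ∑ j ∈ range (N + 1), c j| + |φ (M + 1) * ∑ j ∈ range (M + 1), c j| +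
        |∑ i ∈ Ioc M (N - 1), (φ (i + 1) - φ i) * ∑ j ∈ range (i + 1), c j| := by
          refine (abs_sub _ _).trans ?_
          gcongr
          exact abs_sub _ _
    _ ≤ φ N * B + φ (M + 1) * B + B * (φ (M + 1) - φ N) := by linarith
    _ = 2 * B * φ (M + 1) := by ring

/-! ### The prime sums `M_N(s) = ∑_{p ≤ N} (g(p) − κ/p) p^{-s}` are uniformly Cauchy -/

/-- A sum over the primes `p ≤ N` is the sum over `range (N+1)` of the function extended by `0`.
[folklore] -/
theorem sum_primesLE_eq_sum_range_ite (h : ℕ → ℝ) (N : ℕ) :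
    ∑ p ∈ Nat.primesLE N, h p = ∑ n ∈ range (N + 1), if n.Prime then h n else 0 := by
  rw [Nat.primesLE_eq_filter_range, Finset.sum_filter]

/-- The difference of two prime sums `∑_{p ≤ N} − ∑_{p ≤ M}` (`M ≤ N`) is the sum over
`M < n ≤ N` of the function extended by `0` off the primes. [folklore] -/
theorem sum_primesLE_sub_sum_primesLE (h : ℕ → ℝ) {M N : ℕ} (hMN : M ≤ N) :
    ∑ p ∈ Nat.primesLE N, h p - ∑ p ∈ Nat.primesLE M, h p
      = ∑ n ∈ Ioc M N, if n.Prime then h n else 0 := by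
  rw [sum_primesLE_eq_sum_range_ite, sum_primesLE_eq_sum_range_ite,
    ← Finset.sum_Ico_eq_sub _ (by omega : M + 1 ≤ N + 1), Finset.Ico_add_one_add_one_eq_Ioc]

/-- **Uniform Cauchy property of the conditionally convergent prime sum.** If the partial sums
`∑_{p ≤ N} (g(p) − κ/p) log p` are bounded by `B`, then for all real `s ≥ 0` and `N ≥ M ≥ 1`,
`|∑_{p ≤ N} (g(p) − κ/p) p^{-s} − ∑_{p ≤ M} (g(p) − κ/p) p^{-s}| ≤ 2B / log(M+1)`
(Abel summation against the weight `1/(n^s log n)`, which is positive and non-increasing in `n ≥ 2`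
and at most `1/log n`). [cite: HalberstamRichert1974, Lemma 5.3] -/
theorem abs_sum_primesLE_div_rpow_sub_le (g : ℕ → ℝ) (κ : ℝ) {B : ℝ}
    (hB : ∀ N : ℕ, |∑ p ∈ Nat.primesLE N, (g p - κ / p) * Real.log p| ≤ B)
    {s : ℝ} (hs : 0 ≤ s) {M N : ℕ} (hM : 1 ≤ M) (hMN : M ≤ N) :
    |(∑ p ∈ Nat.primesLE N, (g p - κ / p) / (p : ℝ) ^ s) -
        ∑ p ∈ Nat.primesLE M, (g p - κ / p) / (p : ℝ) ^ s| ≤ 2 * B / Real.log (M + 1) := by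
  -- the coefficients and the weight
  set c : ℕ → ℝ := fun n => if n.Prime then (g n - κ / n) * Real.log n else 0 with hc
  set φ : ℕ → ℝ := fun n => 1 / ((n : ℝ) ^ s * Real.log n) with hφ
  have hC : ∀ k, |∑ j ∈ range k, c j| ≤ B := by
    intro k
    rcases k with _ | N
    · simpa using (abs_nonneg _).trans (hB 0)
    · rw [hc, ← sum_primesLE_eq_sum_range_ite]
      exact hB N
  have hpos : ∀ i : ℕ, M < i → 0 < (i : ℝ) ^ s * Real.log i := by
    intro i hi
    have hi2 : (2 : ℝ) ≤ i := by exact_mod_cast (show 2 ≤ i by omega)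
    exact mul_pos (Real.rpow_pos_of_pos (by linarith) _) (Real.log_pos (by linarith))
  have hφ0 : ∀ i, M < i → 0 ≤ φ i := fun i hi => by
    rw [hφ]; exact div_nonneg zero_le_one (hpos i hi).le
  have hφmono : ∀ i, M < i → φ (i + 1) ≤ φ i := by
    intro i hi
    have hi2 : (2 : ℝ) ≤ i := by exact_mod_cast (show 2 ≤ i by omega)
    simp only [hφ]
    push_cast
    refine one_div_le_one_div_of_le (hpos i hi) ?_
    refine mul_le_mul (Real.rpow_le_rpow (by linarith) (by linarith) hs)
      (Real.log_le_log (by linarith) (by linarith)) (Real.log_pos (by linarith)).le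
      (Real.rpow_nonneg (by linarith) _)
  -- the difference is `∑_{M < n ≤ N} φ n * c n`
  have hdiff : (∑ p ∈ Nat.primesLE N, (g p - κ / p) / (p : ℝ) ^ s) -
      ∑ p ∈ Nat.primesLE M, (g p - κ / p) / (p : ℝ) ^ s = ∑ n ∈ Ioc M N, φ n * c n := by
    rw [sum_primesLE_sub_sum_primesLE _ hMN]
    refine Finset.sum_congr rfl fun n hn => ?_
    simp only [hc, hφ]
    split_ifs with hp
    · have hn2 : (2 : ℝ) ≤ n := by exact_mod_cast hp.two_le
      have hlog : Real.log n ≠ 0 := (Real.log_pos (by linarith)).ne'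
      have hpow : (n : ℝ) ^ s ≠ 0 := (Real.rpow_pos_of_pos (by linarith) _).ne'
      field_simp
    · simp
  rw [hdiff]
  refine (abs_sum_Ioc_mul_le c φ hMN hC hφ0 hφmono).trans ?_
  -- `2 B φ (M+1) ≤ 2 B / log (M+1)`
  have hB0 : 0 ≤ B := (abs_nonneg _).trans (hB 0)
  have hM2 : (2 : ℝ) ≤ (M + 1 : ℕ) := by exact_mod_cast (show 2 ≤ M + 1 by omega)
  have hlog : 0 < Real.log ((M + 1 : ℕ) : ℝ) := Real.log_pos (by linarith)
  have hone : 1 ≤ ((M + 1 : ℕ) : ℝ) ^ s := Real.one_le_rpow (by linarith) hs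
  simp only [hφ]
  rw [mul_one_div]
  push_cast at hlog hone ⊢
  refine div_le_div_of_nonneg_left (by positivity) hlog ?_
  calc Real.log ((M : ℝ) + 1) = 1 * Real.log ((M : ℝ) + 1) := (one_mul _).symm
    _ ≤ ((M : ℝ) + 1) ^ s * Real.log ((M : ℝ) + 1) :=
        mul_le_mul_of_nonneg_right hone hlog.le

/-! ### Bounded partial sums from the prime mean hypothesis and Mertens' first theorem -/

/-- **(H1) + Mertens I ⇒ bounded `C(N)`.** If `|∑_{p ≤ Q} g(p) log p − κ log Q| ≤ L` for all
`Q ≥ 2` and `κ ≥ 0`, then `|∑_{p ≤ N} (g(p) − κ/p) log p| ≤ L + 4κ` for every `N`, by Mertens'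
first theorem `|∑_{p ≤ N} log p / p − log N| ≤ 4`
(`Literature.NumberTheory.LFunctions.MertensBound.sum_log_div_prime_bounds`).
[cite: HalberstamRichert1974, Lemma 5.3] -/
theorem exists_abs_sum_primesLE_sub_mul_log_le (g : ℕ → ℝ) {κ : ℝ} (hκ : 0 ≤ κ)
    (h1 : ∃ L : ℝ, ∀ Q : ℕ, 2 ≤ Q →
      |(∑ p ∈ Nat.primesLE Q, g p * Real.log p) - κ * Real.log Q| ≤ L) :
    ∃ B : ℝ, ∀ N : ℕ, |∑ p ∈ Nat.primesLE N, (g p - κ / p) * Real.log p| ≤ B := by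
  obtain ⟨L, hL⟩ := h1
  have hL0 : 0 ≤ L := (abs_nonneg _).trans (hL 2 le_rfl)
  refine ⟨L + κ * 4, fun N => ?_⟩
  rcases lt_or_ge N 2 with hN | hN
  · interval_cases N
    · simp only [Nat.primesLE_zero, Finset.sum_empty, abs_zero]; positivity
    · simp only [Nat.primesLE_one, Finset.sum_empty, abs_zero]; positivity
  have hm := Literature.NumberTheory.LFunctions.MertensBound.sum_log_div_prime_bounds
    (t := (N : ℝ)) (by exact_mod_cast (show 1 ≤ N by omega))
  rw [Nat.floor_natCast] at hm
  have hsplit : ∑ p ∈ Nat.primesLE N, (g p - κ / p) * Real.log p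
      = ((∑ p ∈ Nat.primesLE N, g p * Real.log p) - κ * Real.log N)
        - κ * ((∑ p ∈ Nat.primesLE N, Real.log p / p) - Real.log N) := by
    have : ∀ p ∈ Nat.primesLE N,
        (g p - κ / p) * Real.log p = g p * Real.log p - κ * (Real.log p / p) := by
      intro p _; ring
    rw [Finset.sum_congr rfl this, Finset.sum_sub_distrib, ← Finset.mul_sum]
    ring
  rw [hsplit]
  have hA := hL N hN
  have hE : |(∑ p ∈ Nat.primesLE N, Real.log p / p) - Real.log N| ≤ 4 := by
    rw [abs_le]; constructor <;> linarith [hm.1, hm.2]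
  calc |((∑ p ∈ Nat.primesLE N, g p * Real.log p) - κ * Real.log N)
        - κ * ((∑ p ∈ Nat.primesLE N, Real.log p / p) - Real.log N)|
      ≤ |(∑ p ∈ Nat.primesLE N, g p * Real.log p) - κ * Real.log N|
        + |κ * ((∑ p ∈ Nat.primesLE N, Real.log p / p) - Real.log N)| := abs_sub _ _
    _ ≤ L + κ * 4 := by
        rw [abs_mul, abs_of_nonneg hκ]
        exact add_le_add hA (mul_le_mul_of_nonneg_left hE hκ)

end LevinFainleib

end Literature.NumberTheory.LFunctions
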